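import Literature.Probability.Percolation.AdjOutScheme
import Literature.Probability.Percolation.FlipFourArm
import Literature.Probability.Percolation.AltFourArmGlue
import Literature.Probability.Percolation.KestenRelationRussoFromSeparationFacts
import Literature.Probability.Percolation.ArmSeparationNearCriticalFour
import Literature.Probability.Percolation.ArmSeparationFourArmProofs
import Literature.Probability.Percolation.KestenScalingProofs
import HarnessLib

/-!
# The adjacent four-arm landing at criticality, proved; Kesten's pivotal count and scaling relation

Topic `Literature/Probability/Percolation`; family `crit-perc` (critical and near-critical site
percolation on the triangular lattice `𝕋`). PROOFS ONLY (no definition, no named fact).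

P. Nolin, *Near-critical percolation in two dimensions*, EJP 13 (2008), proves the arm-separation
theorem (§4.3 Thm. 11 [arXiv 0711.4948: Thm. 10], after H. Kesten, CMP 109 (1987), Lemmas 4–6) for
every number of arms and every colour sequence, in two halves (§4.4: external extremities
pp. 11–13, internal extremities p. 13). For four arms in the ADJACENT arrangement `σ = BBWW` the
tree proves the EXTERNAL half at every density `p` with Russo–Seymour–Welsh inputs
(`exists_real_adjFourArmCyc_le_mul_extFourArmQ_at`'s twin `exists_real_adjFourArmCyc_le_mul_extFourAdjR_at`,
`AdjOutScheme.lean`: `P_p(adjFourArmCyc n N) ≤ C · P_p(extFourAdjR n N)`), and the named fact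
`Nolin2008_adjFourArm_landing` (`FourArmSeparationFacts.lean`) asks, at `p = 1/2`, for external
landing only: `c · P_{1/2}(adjFourArm n N) ≤ P_{1/2}(landedFourAdj n N)`. This file closes the gap:

* `extOpenArm_exists_arm`, `extOpenArm_exists_arm_frame`, `rotConfig_inter_eq` — an externally
  fenced arm (`extOpenArm`, read in the frame of side `i`) contains a plain arm of the closed
  annulus from `∂Λ_n` to SIDE `i` of `∂Λ_N` (trimming at the first exit from `Λ_N`, which happens
  through the attaching ball inside the open cone over the side: `PathIn.exists_landedArm`);
* `extFourAdjR_subset_landedFourAdj` — hence the externally fenced adjacent event lies in the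
  tree's `landedFourAdj` (open arms ending on the sides `0, 1`, closed arms on the sides `3, 4`);
* `exists_real_adjFourArmCyc_le_mul_extFourAdjR_half` — the outer scheme at `p = 1/2`, fed with
  `tri_rsw_half_holds` (RSW at `1/2` at the aspect ratios `4`, `1024`, `256 · 32^K`) and
  `le_real_triFrameAt_of_rsw`;
* `Nolin2008_adjFourArm_landing_holds` — **the named fact `Nolin2008_adjFourArm_landing` is a
  theorem** (`adjFourArm ⊆ adjFourArmCyc`, the two items above);
* `Werner2009_lemma62_holds` — **Werner's Lemma 6.2 (the pivotal count `Σ_x P_t(x pivotal) ≍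
  N² π₄(N)` below `L(t)`) is a theorem**: the tree's assembly `Werner2009_lemma62_holds_of` fed
  with the alternating separation theorem `altSeparation_display` (`ArmSeparationNearCriticalFour.lean`)
  and the landing just proved; `Nolin2008_prop34_holds` — **Kesten's scaling relation in Nolin's
  normalisation (Prop. 34)**, by `Nolin2008_prop34_of_lemma62`;
* `critFourArm_separation_half`, `critFourArmProb_quasiMult_half`, `critFourArmProb_quasiMult_spaced` —
  at `p = 1/2` the ORDER-FREE four-arm probability `π₄ = critFourArmProb = P_{1/2}(armEvent ![T,F,T,F])`
  separates onto `sepFourArm` (`critFourArm_separation_of_alt` with the colour-exchange bridge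
  `fourArm_bridge_of_landing`, Nolin §5.1 Prop. 20 [arXiv Prop. 19], proved in `FlipFourArm.lean`),
  hence is quasi-multiplicative (`critFourArmProb_quasiMult_of_separation`; Nolin §4.5 Prop. 17
  [arXiv Prop. 16] for `j = 4`, both cyclic arrangements of two black and two white arms at once).

## References

* P. Nolin, Near-critical percolation in two dimensions, *Electron. J. Probab.* 13 (2008)
  1562–1623, §4.2 Def. 6–8, §4.3 Thm. 11, Prop. 12, §4.4, §4.5 Prop. 17, §5.1 Prop. 20, §7.3
  Prop. 34 (arXiv 0711.4948: Def. 6–8, Thm. 10, Prop. 11, Prop. 16, Prop. 19, Prop. 32) [Nolin2008].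
* H. Kesten, Scaling relations for 2D-percolation, *Comm. Math. Phys.* 109 (1987) 109–156,
  Lemmas 4–6, (4.5) [KestenScalingCMP1987].
* W. Werner, *Lectures on two-dimensional critical percolation*, IAS/Park City Math. Ser. 16
  (2009), Lecture 6, Prop. 6.1, Lemma 6.2 [WernerPCMI2009].
* S. Smirnov, W. Werner, Critical exponents for two-dimensional percolation, *Math. Res. Lett.* 8
  (2001) 729–744, §4 (10) [SmirnovWernerMRL2001].

Tree: `extOpenArm` (`ArmSeparationExtArm.lean`); `extOpenDuoR`, `rotConfig_rotConfig`
(`AdjDuoLanding.lean`); `extFourAdjR` (`AdjProb.lean`); `exists_real_adjFourArmCyc_le_mul_extFourAdjR_at`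
(`AdjOutScheme.lean`); `adjFourArmCyc`, `adjFourArm_subset_adjFourArmCyc` (`AdjFourArmCyclic.lean`);
`landedFourAdj`, `adjFourArm`, `critFourArm_separation_of_alt`, `critAltFourArm_separation_of_nearCritical`
(`ArmPatternsFourArm.lean`); `fourArm_bridge_of_landing` (`FlipFourArm.lean`); `PathIn.exists_landedArm`
(`AltFourArmGlue.lean`); `hexSide`, `image_rot_hexSide`, `mem_hexSide_zero`, `coord_of_mem_hexSide_one/three/four`,
`triNorm_of_mem_hexSide` (`LandedAltFourArm.lean`); `altSeparation_display` (`ArmSeparationNearCriticalFour.lean`);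
`Werner2009_lemma62_holds_of` (`KestenRelationRussoFromSeparationFacts.lean`); `Nolin2008_prop34_of_lemma62`
(`KestenScalingProofs.lean`); `critFourArmProb_quasiMult_of_separation`,
`critFourArmProb_quasiMult_spaced_of_separation` (`ArmSeparationFourArmProofs.lean`);
`tri_rsw_half_holds` (`TriThetaHalf.lean`); `le_real_triFrameAt_of_rsw` (`ArmSeparationFenceBoundAt.lean`);
`nat_floor_natCast_mul` (`FiveArmLowerBound.lean`); `pathIn_map_iso`, `mem_rotConfig`, `triNorm_rot`,
`lt_triNorm_of_mem_sepOuterFence`, `disjoint_inter_colour`, `setOf_mem_iff_true/false`.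
-/

noncomputable section

open MeasureTheory Set

namespace Literature.Probability.Percolation

open LatticeModels

/-! ### Trimming an externally fenced arm to a plain arm landed on its side -/

/-- **An externally fenced open arm contains a plain arm landed on side `0`** (`4 ≤ n ≤ N`): the
open path of `extOpenArm n N` from a site of norm `n` to the outer free space leaves `Λ_N` through
the attaching ball `S̊_{N/8}(z)`, which lies in the open cone over side `0`, so the site before the
first exit lies on side `0` (`PathIn.exists_landedArm`). [cite: Nolin2008, §4.2 Def. 7–8 (arXiv 0711.4948: Def. 6–8: Ã̃ ⊆ Ā)] -/
theorem extOpenArm_exists_arm {n N : ℕ} (h4 : 4 ≤ n) (hnN : n ≤ N) {ω : SiteConfig (Site 2)}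
    (h : ω ∈ extOpenArm n N) :
    ∃ x y : Site 2, triNorm x = n ∧ y ∈ hexSide N 0 ∧
      PathIn triGraph ({w : Site 2 | (n : ℤ) ≤ triNorm w ∧ triNorm w ≤ N} ∩ ω) x y := by
  obtain ⟨z, u', a, hz, ha, ⟨b, t, -, -, pF, -⟩, hP⟩ := h
  have hu'N : (N : ℤ) < triNorm u' := lt_triNorm_of_mem_sepOuterFence pF.right_mem.1
  have hnN' : (n : ℤ) ≤ N := by exact_mod_cast hnN
  rw [mem_sepLanding] at hz
  have hZ : ∀ w ∈ (triAnnulusSet n N ∪ triOpenBall z (N / 8)), (N : ℤ) < triNorm w →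
      (0 < w 0 ∧ w 1 < 0 ∧ 0 < w 0 + w 1) := by
    intro w hw hNw
    rcases hw with hw | hw
    · rw [mem_triAnnulusSet] at hw; omega
    · rw [mem_triOpenBall, triNorm_lt_iff_lin] at hw
      simp only [Pi.sub_apply] at hw
      exact ⟨by omega, by omega, by omega⟩
  obtain ⟨x, y, hx, hy, Q⟩ := PathIn.exists_landedArm hP (le_of_eq ha) hu'N hnN hZ
  exact ⟨x, y, hx, hy, Q.mono fun w hw => ⟨hw.1, hw.2.2⟩⟩

/-- **The same in the frame of side `i`**: if `rotConfig i ω` has an externally fenced open arm,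
then `ω` has a plain open arm of the closed annulus from `∂Λ_n` to side `i` of `∂Λ_N`. [cite: Nolin2008, §4.2 Def. 7–8 (arXiv 0711.4948: Def. 6–8)] -/
theorem extOpenArm_exists_arm_frame (i : ℕ) {n N : ℕ} (h4 : 4 ≤ n) (hnN : n ≤ N)
    {ω : SiteConfig (Site 2)} (h : rotConfig i ω ∈ extOpenArm n N) :
    ∃ x y : Site 2, triNorm x = n ∧ y ∈ hexSide N i ∧
      PathIn triGraph ({w : Site 2 | (n : ℤ) ≤ triNorm w ∧ triNorm w ≤ N} ∩ ω) x y := by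
  obtain ⟨x, y, hx, hy, Q⟩ := extOpenArm_exists_arm h4 hnN h
  refine ⟨triRotIsoPow i x, triRotIsoPow i y, by rw [triNorm_rot]; exact hx, ?_, ?_⟩
  · have : triRotIsoPow i y ∈ triRotIsoPow i '' hexSide N 0 := ⟨y, hy, rfl⟩
    rwa [image_rot_hexSide, zero_add] at this
  · refine (pathIn_map_iso (triRotIsoPow i) Q).mono ?_
    rintro w ⟨v, ⟨hv, hvω⟩, rfl⟩
    refine ⟨?_, mem_rotConfig.1 hvω⟩
    simp only [mem_setOf_eq, triNorm_rot] at hv ⊢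
    exact hv

/-- Intersecting a rotated configuration with a set of sites is rotating the intersection with the
rotated set. [folklore] -/
theorem rotConfig_inter_eq (i : ℕ) (ω : SiteConfig (Site 2)) (X : Set (Site 2)) :
    rotConfig i ω ∩ X = rotConfig i (ω ∩ triRotIsoPow i '' X) := by
  ext v
  simp only [mem_inter_iff, mem_rotConfig]
  constructor
  · rintro ⟨h1, h2⟩; exact ⟨h1, v, h2, rfl⟩
  · rintro ⟨h1, u, hu, huv⟩
    exact ⟨h1, by rwa [← (triRotIsoPow i).injective huv]⟩

/-- **The externally fenced adjacent four-arm event lies in `landedFourAdj`** (`4 ≤ n ≤ N`): its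
two open arms (carriers `X`, `Y`, frames `0`, `1`) and its two closed arms (frames `3`, `4` of the
complement) are trimmed to plain arms of the closed annulus ending on the sides `0, 1, 3, 4`
(`extOpenArm_exists_arm_frame`), pairwise disjoint (carriers within a colour, colours otherwise),
and made self-avoiding (`SimpleGraph.Walk.toPath`). [cite: Nolin2008, §4.2 Def. 7–8 (arXiv 0711.4948: Def. 6–8: Ã̃ ⊆ Ā), σ = BBWW] -/
theorem extFourAdjR_subset_landedFourAdj {n N : ℕ} (h4 : 4 ≤ n) (hnN : n ≤ N) :
    extFourAdjR n N ⊆ landedFourAdj n N := by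
  classical
  rintro χ ⟨⟨X, Y, hXY, hA₀, hA₂⟩, ⟨X', Y', hXY', hA₁, hA₃⟩⟩
  -- the four plain arms
  have hA₀' : rotConfig 0 (χ ∩ X) ∈ extOpenArm n N := by
    have : rotConfig 0 (χ ∩ X) = χ ∩ X := by ext v; simp [mem_rotConfig, triRotIsoPow]
    rwa [this]
  obtain ⟨x₀, y₀, hx₀, hy₀, P₀⟩ := extOpenArm_exists_arm_frame 0 h4 hnN hA₀'
  obtain ⟨x₂, y₂, hx₂, hy₂, P₂⟩ := extOpenArm_exists_arm_frame 1 h4 hnN hA₂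
  rw [rotConfig_inter_eq] at hA₁
  obtain ⟨x₁, y₁, hx₁, hy₁, P₁⟩ := extOpenArm_exists_arm_frame 3 h4 hnN hA₁
  rw [rotConfig_inter_eq, rotConfig_rotConfig] at hA₃
  obtain ⟨x₃, y₃, hx₃, hy₃, P₃⟩ := extOpenArm_exists_arm_frame (1 + 3) h4 hnN hA₃
  set Ann : Set (Site 2) := {w : Site 2 | (n : ℤ) ≤ triNorm w ∧ triNorm w ≤ N} with hAnn
  -- the four site sets
  set Tset : Fin 4 → Set (Site 2) :=
    ![(Ann ∩ X) ∩ {v | v ∈ χ ↔ true}, (Ann ∩ triRotIsoPow 3 '' X') ∩ {v | v ∈ χ ↔ false},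
      (Ann ∩ Y) ∩ {v | v ∈ χ ↔ true}, (Ann ∩ triRotIsoPow 3 '' Y') ∩ {v | v ∈ χ ↔ false}] with hTset
  set xs : Fin 4 → Site 2 := ![x₀, x₁, x₂, x₃] with hxs
  set ys : Fin 4 → Site 2 := ![y₀, y₁, y₂, y₃] with hys
  have eT : ∀ (C : Set (Site 2)), Ann ∩ (χ ∩ C) ⊆ (Ann ∩ C) ∩ {v | v ∈ χ ↔ true} :=
    fun C w hw => ⟨⟨hw.1, hw.2.2⟩, by simpa using hw.2.1⟩
  have eF : ∀ (C : Set (Site 2)), Ann ∩ (χᶜ ∩ C) ⊆ (Ann ∩ C) ∩ {v | v ∈ χ ↔ false} :=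
    fun C w hw => ⟨⟨hw.1, hw.2.2⟩, by simpa using hw.2.1⟩
  have hp : ∀ j : Fin 4, PathIn triGraph (Tset j) (xs j) (ys j) := by
    intro j; fin_cases j
    · exact P₀.mono (eT X)
    · exact P₁.mono (eF _)
    · exact P₂.mono (eT Y)
    · exact P₃.mono (eF _)
  have hW : ∀ j, ∃ W : triGraph.Walk (xs j) (ys j), ∀ z ∈ W.support, z ∈ Tset j :=
    fun j => (hp j).exists_walk
  choose W hWs using hW
  have hXY3 : Disjoint (triRotIsoPow 3 '' X') (triRotIsoPow 3 '' Y') :=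
    (Set.disjoint_image_iff (triRotIsoPow 3).injective).2 hXY'
  have d02 : Disjoint (Tset 0) (Tset 2) :=
    Disjoint.mono (inter_subset_left.trans inter_subset_right) (inter_subset_left.trans inter_subset_right) hXY
  have d13 : Disjoint (Tset 1) (Tset 3) :=
    Disjoint.mono (inter_subset_left.trans inter_subset_right) (inter_subset_left.trans inter_subset_right) hXY3
  have hdT : Pairwise fun i j => Disjoint (Tset i) (Tset j) := by
    intro i j hij
    fin_cases i <;> fin_cases j
    all_goals first
      | exact absurd rfl hij
      | exact d02 | exact d02.symm | exact d13 | exact d13.symm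
      | exact disjoint_inter_colour (by decide)
  have hcolT : ∀ i, ∀ z ∈ Tset i, (z ∈ χ ↔ (![true, false, true, false] : Fin 4 → Bool) i = true) := by
    intro i z hz
    fin_cases i <;> simpa [hTset] using hz.2
  have hannT : ∀ i, ∀ z ∈ Tset i, (n : ℤ) ≤ triNorm z ∧ triNorm z ≤ N := by
    intro i z hz
    fin_cases i <;> exact (by simpa [hTset, hAnn] using hz.1.1)
  have hxn : ∀ j, triNorm (xs j) = n := by
    intro j; fin_cases j
    · exact hx₀
    · exact hx₁
    · exact hx₂
    · exact hx₃
  have hyn : ∀ j, triNorm (ys j) = N := by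
    intro j; fin_cases j
    · exact triNorm_of_mem_hexSide hy₀
    · exact triNorm_of_mem_hexSide hy₁
    · exact triNorm_of_mem_hexSide hy₂
    · exact triNorm_of_mem_hexSide hy₃
  refine ⟨xs, ys, fun j => ((W j).toPath : triGraph.Walk (xs j) (ys j)), fun j => ?_, ?_, ?_⟩
  · have hsub : ∀ z ∈ ((W j).toPath : triGraph.Walk (xs j) (ys j)).support, z ∈ Tset j :=
      fun z hz => hWs j z (SimpleGraph.Walk.support_toPath_subset_support (W j) hz)
    refine ⟨mem_triSphere_iff.2 (hxn j), mem_triSphere_iff.2 (hyn j), (W j).toPath.2, fun z hz => ?_,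
      fun z hz => ?_⟩
    · obtain ⟨h1, h2⟩ := hannT j z (hsub z hz)
      rcases eq_or_lt_of_le h1 with h1 | h1
      · right; rw [mem_triSphere_iff, ← h1]
      · left
        simp only [mem_sdiff, Finset.mem_coe, mem_triBall_iff, not_le]
        exact ⟨h2, h1⟩
    · have := hcolT j z (hsub z hz)
      simpa using this
  · intro i j hij
    rw [Finset.disjoint_left]
    intro z hzi hzj
    have hi := hWs i z (SimpleGraph.Walk.support_toPath_subset_support (W i) (List.mem_toFinset.1 hzi))
    have hj := hWs j z (SimpleGraph.Walk.support_toPath_subset_support (W j) (List.mem_toFinset.1 hzj))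
    exact Set.disjoint_left.1 (hdT hij) hi hj
  · refine ⟨?_, ?_, ?_, ?_⟩
    · show y₀ 0 = N
      exact (mem_hexSide_zero.1 hy₀).1
    · show y₂ 0 + y₂ 1 = N
      exact (coord_of_mem_hexSide_one hy₂).1
    · show y₁ 0 = -(N : ℤ)
      exact (coord_of_mem_hexSide_three hy₁).1
    · show y₃ 0 + y₃ 1 = -(N : ℤ)
      exact (coord_of_mem_hexSide_four hy₃).1

/-! ### The outer scheme at `p = 1/2` -/

/-- **The external half of Nolin's Thm. 11 for `σ = BBWW` at criticality**: there are `C > 0` and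
`n₀` with `P_{1/2}(adjFourArmCyc n N) ≤ C · P_{1/2}(extFourAdjR n N)` for `n₀ ≤ n`, `2n ≤ N` — the
outer scheme `exists_real_adjFourArmCyc_le_mul_extFourAdjR_at` at `p = 1/2 = 1 - p`, whose frame
and Russo–Seymour–Welsh inputs hold at every height by `tri_rsw_half_holds` (aspect ratios `4`,
`1024`, `256 · 32^K`) and `le_real_triFrameAt_of_rsw`; the cap `Ncap` is taken equal to `N`. [cite: Nolin2008, §4.3 Thm. 11, σ = BBWW, external extremities (arXiv 0711.4948: Thm. 10, §4.4 pp. 11–13)] -/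
theorem exists_real_adjFourArmCyc_le_mul_extFourAdjR_half :
    ∃ C : ℝ, 0 < C ∧ ∃ n₀ : ℕ, ∀ n N : ℕ, n₀ ≤ n → 2 * n ≤ N →
      (triSitePercolation half).real (adjFourArmCyc n N) ≤
        C * (triSitePercolation half).real (extFourAdjR n N) := by
  obtain ⟨c₄, hc₄, h₄⟩ := tri_rsw_half_holds ((4 : ℕ) : ℝ) (by norm_num)
  obtain ⟨c, hc, h₁₀₂₄⟩ := tri_rsw_half_holds ((1024 : ℕ) : ℝ) (by norm_num)
  have hfl4 : ∀ k : ℕ, ⌊((4 : ℕ) : ℝ) * k⌋₊ = 4 * k := fun k => nat_floor_natCast_mul 4 k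
  have hfl : ∀ k : ℕ, ⌊((1024 : ℕ) : ℝ) * k⌋₊ = 1024 * k := fun k => nat_floor_natCast_mul 1024 k
  have hc₄1 : c₄ ≤ 1 := ((h₄ 1 (by rw [hfl4]; norm_num)).1).trans measureReal_le_one
  have hc1 : c ≤ 1 := ((h₁₀₂₄ 1 (by rw [hfl]; norm_num)).1).trans measureReal_le_one
  have hcF : 0 < c₄ ^ 4 := by positivity
  have hcF1 : c₄ ^ 4 ≤ 1 := pow_le_one₀ hc₄.le hc₄1
  obtain ⟨K, hK⟩ := exists_real_adjFourArmCyc_le_mul_extFourAdjR_at hcF hcF1 hc hc1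
  obtain ⟨cL, hcL, hL⟩ := tri_rsw_half_holds ((256 * 32 ^ K : ℕ) : ℝ) (by positivity)
  have hflL : ∀ k : ℕ, ⌊((256 * 32 ^ K : ℕ) : ℝ) * k⌋₊ = 256 * 32 ^ K * k := fun k =>
    nat_floor_natCast_mul (256 * 32 ^ K) k
  have hcL1 : cL ≤ 1 := by
    have h1 : 1 ≤ ⌊((256 * 32 ^ K : ℕ) : ℝ) * (1 : ℕ)⌋₊ := by
      rw [hflL, mul_one]; exact le_trans (by norm_num) (Nat.mul_le_mul_left 256 (Nat.one_le_pow _ _ (by norm_num)))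
    exact ((hL 1 h1).1).trans measureReal_le_one
  obtain ⟨C, hC, n₀, hmain⟩ := hK cL hcL hcL1
  refine ⟨C, hC, n₀, fun n N hn hnN => ?_⟩
  have hq : ∀ q : unitInterval, (q = half ∨ q = unitInterval.symm half) → q = half := by
    rintro q (rfl | rfl)
    · rfl
    · exact symm_half
  refine hmain half N ?_ ?_ ?_ n N hn hnN le_rfl
  · intro q hq' z k hk _
    rw [hq q hq']
    have h := (h₄ k (by rw [hfl4]; omega)).1
    rw [hfl4] at h
    exact le_real_triFrameAt_of_rsw half hc₄.le z k h
  · intro q hq' k hk _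
    rw [hq q hq']
    exact (h₁₀₂₄ k hk).1
  · intro q hq' k hk _
    rw [hq q hq']
    exact (hL k hk).1

/-! ### The discharges -/

/-- **Nolin's Thm. 11 for `σ = BBWW` at `p = 1/2`, external landing — the named fact
`Nolin2008_adjFourArm_landing` is a theorem**: `c · P_{1/2}(adjFourArm n N) ≤ P_{1/2}(landedFourAdj n N)`
for `n₀ ≤ n`, `2n ≤ N`, with `c = 1/C` (`adjFourArm ⊆ adjFourArmCyc`, the outer scheme at `1/2`,
`extFourAdjR ⊆ landedFourAdj`). [cite: Nolin2008, §4.3 Thm. 11, j = 4, σ = BBWW, p = 1/2 (arXiv 0711.4948: Thm. 10); §5.1, proof of Prop. 20 (arXiv Prop. 19)] -/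
theorem Nolin2008_adjFourArm_landing_holds : Nolin2008_adjFourArm_landing := by
  obtain ⟨C, hC, n₀, h⟩ := exists_real_adjFourArmCyc_le_mul_extFourAdjR_half
  refine ⟨1 / C, by positivity, max n₀ 4, fun n N hn hnN => ?_⟩
  have hn₀ : n₀ ≤ n := le_trans (le_max_left _ _) hn
  have h4 : 4 ≤ n := le_trans (le_max_right _ _) hn
  calc 1 / C * (triSitePercolation half).real (adjFourArm n N)
      ≤ 1 / C * (triSitePercolation half).real (adjFourArmCyc n N) :=
        mul_le_mul_of_nonneg_left (measureReal_mono (adjFourArm_subset_adjFourArmCyc (by omega) (by omega))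
          (measure_ne_top _ _)) (by positivity)
    _ ≤ 1 / C * (C * (triSitePercolation half).real (extFourAdjR n N)) :=
        mul_le_mul_of_nonneg_left (h n N hn₀ hnN) (by positivity)
    _ = (triSitePercolation half).real (extFourAdjR n N) := by field_simp
    _ ≤ (triSitePercolation half).real (landedFourAdj n N) :=
        measureReal_mono (extFourAdjR_subset_landedFourAdj h4 (by omega)) (measure_ne_top _ _)

/-- **Werner's Lemma 6.2 — the named fact `Werner2009_lemma62` is a theorem**: the tree's assembly
`Werner2009_lemma62_holds_of` (`KestenRelationRussoFromSeparationFacts.lean`) from the alternating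
separation theorem `altSeparation_display` (verbatim the fact `Nolin2008_altFourArm_separation`)
and `Nolin2008_adjFourArm_landing_holds`. [cite: WernerPCMI2009, Lecture 6, Lemma 6.2 (with Prop. 6.1 and Lemma 6.3)] [cite: Nolin2008, §7.3, proof of Prop. 34 (arXiv 0711.4948: Prop. 32)] -/
theorem Werner2009_lemma62_holds : Werner2009_lemma62 :=
  Werner2009_lemma62_holds_of altSeparation_display Nolin2008_adjFourArm_landing_holds

/-- **Kesten's scaling relation in Nolin's normalisation — the named fact `Nolin2008_prop34` is a
theorem** (`Nolin2008_prop34_of_lemma62`, `KestenScalingProofs.lean`). [cite: Nolin2008, §7.3 Prop. 34 (arXiv 0711.4948: Prop. 32)] [cite: KestenScalingCMP1987, (4.5)] -/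
theorem Nolin2008_prop34_holds : Nolin2008_prop34 :=
  Nolin2008_prop34_of_lemma62 Werner2009_lemma62_holds

/-! ### The order-free four-arm probability at criticality: separation and quasi-multiplicativity -/

/-- **Order-free four-arm separation at `p = 1/2`**: there are `c > 0`, `n₀` with
`c · π₄(n, N) ≤ P_{1/2}(sepFourArm n N)` for `n₀ ≤ n`, `2n ≤ N` (`π₄ = critFourArmProb`, the
tree's ORDER-FREE `P_{1/2}(armEvent ![T,F,T,F] n N)`): Nolin's Thm. 11 for `σ = BWBW`
(`altSeparation_display` at `t = 1/2`) and the colour-exchange bridge `c · π₄ ≤ π̂^alt`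
(`fourArm_bridge_of_landing`, Prop. 20, fed with `Nolin2008_adjFourArm_landing_holds`). This is
the separation hypothesis of `critFourArmProb_quasiMult_of_separation` and of
`fourArm_exponent_of_separation`. [cite: Nolin2008, §4.3 Thm. 11, j = 4, with §5.1 Prop. 20 (arXiv 0711.4948: Thm. 10, Prop. 19)] -/
theorem critFourArm_separation_half :
    ∃ c : ℝ, 0 < c ∧ ∃ n₀ : ℕ, ∀ n N : ℕ, n₀ ≤ n → 2 * n ≤ N →
      c * critFourArmProb n N ≤ (triSitePercolation half).real (sepFourArm n N) :=
  critFourArm_separation_of_alt (critAltFourArm_separation_of_nearCritical altSeparation_display)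
    (fourArm_bridge_of_landing Nolin2008_adjFourArm_landing_holds)

/-- **Quasi-multiplicativity of the critical four-arm probability** (Smirnov–Werner 2001, (10);
Nolin 2008, Prop. 17 for `j = 4`), in the shape (B) of `fourArm_exponent_of_scaleBounds_crit`:
`c · π₄(r, R) · π₄(4R, S) ≤ π₄(r, S)` for `n₀ ≤ r`, `16 r < 4R < S`. [cite: SmirnovWernerMRL2001, §4 (10)] [cite: Nolin2008, §4.5 Prop. 17, j = 4 (arXiv 0711.4948: Prop. 16)] -/
theorem critFourArmProb_quasiMult_half :
    ∃ n₀ : ℕ, ∃ c > (0 : ℝ), ∀ ⦃r R S : ℕ⦄, n₀ ≤ r → 16 * r < 4 * R → 4 * R < S →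
      c * (critFourArmProb r R * critFourArmProb (4 * R) S) ≤ critFourArmProb r S :=
  critFourArmProb_quasiMult_of_separation critFourArm_separation_half

/-- **Quasi-multiplicativity of the critical four-arm probability along well-spaced radii**:
`c · π₄(n₁, n₂) · π₄(n₂, n₃) ≤ π₄(n₁, n₃)` for `n₀ ≤ n₁`, `2048 n₁ ≤ n₂`, `2048 n₂ ≤ n₃`
(`critFourArmProb_quasiMult_spaced_of_separation` at the scales `64q ≤ 512(q+1)`, `q = ⌊n₂/64⌋`,
and monotonicity of `π₄` in both radii). [cite: Nolin2008, §4.5 Prop. 17, j = 4 (arXiv 0711.4948: Prop. 16)] -/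
theorem critFourArmProb_quasiMult_spaced :
    ∃ c : ℝ, 0 < c ∧ ∃ n₀ : ℕ, ∀ n₁ n₂ n₃ : ℕ, n₀ ≤ n₁ → 2048 * n₁ ≤ n₂ → 2048 * n₂ ≤ n₃ →
      c * (critFourArmProb n₁ n₂ * critFourArmProb n₂ n₃) ≤ critFourArmProb n₁ n₃ := by
  obtain ⟨cQ, hcQ, n₀, hQ⟩ := critFourArmProb_quasiMult_spaced_of_separation critFourArm_separation_half
  refine ⟨cQ, hcQ, max n₀ 1, fun n₁ n₂ n₃ hn₁ h12 h23 => ?_⟩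
  have hn₀ : n₀ ≤ n₁ := le_trans (le_max_left _ _) hn₁
  have h1 : 1 ≤ n₁ := le_trans (le_max_right _ _) hn₁
  set q := n₂ / 64 with hq
  have hqn : 64 * q ≤ n₂ := Nat.mul_div_le n₂ 64
  have hnq : n₂ < 64 * (q + 1) := by omega
  have hq1 : 1 ≤ q := by omega
  have key := hQ q n₁ n₃ hq1 hn₀ (by omega) (by omega) (by omega)
  have m₁ : critFourArmProb n₁ n₂ ≤ critFourArmProb n₁ (64 * q) := polyArmProb_anti_holds _ (by omega) hqn
  have m₂ : critFourArmProb n₂ n₃ ≤ critFourArmProb (512 * (q + 1)) n₃ :=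
    polyArmProb_mono_left _ (by omega) (by omega)
  have h0₂ : 0 ≤ critFourArmProb n₂ n₃ := polyArmProb_nonneg _ n₂ n₃
  have h0₃ : 0 ≤ critFourArmProb n₁ (64 * q) := polyArmProb_nonneg _ n₁ (64 * q)
  calc cQ * (critFourArmProb n₁ n₂ * critFourArmProb n₂ n₃)
      ≤ cQ * (critFourArmProb n₁ (64 * q) * critFourArmProb (512 * (q + 1)) n₃) :=
        mul_le_mul_of_nonneg_left (mul_le_mul m₁ m₂ h0₂ h0₃) hcQ.le
    _ ≤ critFourArmProb n₁ n₃ := key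

end Literature.Probability.Percolation

end
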